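import Literature.MathematicalPhysics.QuantumFieldTheory.Balaban1983to89.Node00.HistoryTermDatum214
import Literature.MathematicalPhysics.QuantumFieldTheory.Balaban1983to89.Node00.RateRecordW1Maps

/-!
# BalabanUVNodes ∕ node N22 = NE9 — THE W1 OBJECT ON THE RELATIVE-DISC CENTRED ROAD (RE-TYPING M1′), MODULE J9-D: THE LOCATED INPUTS OF ONE SLICE AS ONE RECORD — the letters and the
# displayed facts that J6 (hMlast, hMprop), J7b + J7a (hMcen) and J8 ((P) for the centre) read AT THE (2.14) DATUM for the window-dilated member of base point `s₀` of the term `(Z, t)` at the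
# configuration `φ`, bundled exactly as node00-def-W1's W1-8 bundles the uncentred (2.26) inputs (`TermDatum214.Inputs226Holo`)

Cell `pub-ymgap`, HUMAN RULING D-0062 (Track A), R134 ACCELERATION re-seat `pub-ymgap-dag-n22-c` (strategy s1), generation 7, file J9-D (DEFINITION LANE: one `structure`, no theorem, no
instance ∕ notation).  Imports W1-7 `Node00/HistoryTermDatum214` and W1's `Node00/RateRecordW1Maps` (the space tables `spaceI`).  Namespace `YMDAG.N22.W1` (this seat's consumer-side
namespace; NOT a W1 object — the ONE-DECLARER rule for `Node00.W1` objects is respected: the record bundles HYPOTHESES of this seat's readings, it defines no term of [II]).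
`--kind definition --supports` K3⁶ `SpineGivenEndpointR13SepCoPR` (stmt-QuantumFields-20509).

WHY.  The knit J9 (`…N22W1RelCentredDatumKnit`: `N22At` at the admissible reading of record from located inputs under the unscaled-field law) composes seven kernel-keyed readings whose
located inputs total ≈ 130 binders per slice; a flat ∃∕∧-tuple of that length does not elaborate in practical time (the `rcases` of a 130-component tuple timed out on the farm at 600 s),
whereas a record with named fields projects in constant time — the design node00-def-W1 chose for W1-8.  THIS FILE is that record: `SliceInputs 𝔇 χᵘ χᶜᵘ 𝒲 𝒪 c Sg Rz cs E₀ κ_E Z t φ s₀ a a₅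
ρb Mv` = the σ∕τ-regions and Cauchy radius; the unscaled-field boxes at `s₀` (signs, measurability, evenness, `χχᶜ ≤ 1`, the box law on `⟨B′,B′⟩ < R²`, (2.22) at radius `r_P`); NODE A's
kernel letters at the configuration (entrywise holomorphy, symmetry, `Re A ≻ 0`, (L17a)∕(L16a), `K_E`, the column fibre bound); the primed letters of the ball `ρb`; the capstone numerics
at the five rates (uncentred `γ₂ + a′`, centred `γ₂ + a_c`, box tail `κ + a₀`, box-free `α₀`, centre `γ₂ + a₀`) and the weight matching; the Lemma-2-type letters of the history-free Wilson
remainder `𝒲` and of the older terms `𝒪` for EVERY history bounded by `E₀·e^{−κ_E d}` on the tables (measurability, the joint (2.20), the member's (2.20) with primed letters on the ball, the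
background value's bounds, holomorphy along bounded holomorphic histories, the exponential-moment Taylor letters with an odd first-order part `𝒱₁`); and the rates `e^{−½κR²} ≤ T·s₀²`,
`e^{−½γ₂(r_P²−r₁²)} ≤ T_P·s₀²`, `1 + T ≤ Mv`, `T_P ≤ Mv`.  Field list GENERATED (`gen/build_slice.py`) as the union of the binder lists of J6 ∕ J7a ∕ J7b ∕ J8 (which were generated from
dag-n10-c's torus theorems), so each field is VERBATIM a hypothesis one of those readings consumes.

HONEST FRAMING.  A LIST OF HYPOTHESES as a type — nothing asserted, nothing of Bałaban's constructed; an inhabitant at the datum of record is NODE A's ∕ N09's ∕ N10's ∕ def-W1's business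
(n10-c module 45 `B13ClippedFieldLetters` supplies the 𝒲∕𝒪-letters generically for the clipped unscaled field); count-neutral; N22 NOT discharged; one finite four-torus programme at fixed ε —
NOT infinite volume, NOT OS on ℝ⁴, NOT a mass gap, NOT Clay.  0 `sorry`, standard axioms.

References (TYPES only): [II] = [Balaban1988RG2Cluster] (1.41) p. 11, (2.14)–(2.26) pp. 15–17; [I] = [Balaban1987RG1] (2.9)–(2.13) pp. 266–268.
-/

noncomputable section

namespace YMDAG.N22.W1

open Set Metric Matrix
open scoped BigOperators
open Literature.MathematicalPhysics.QuantumFieldTheory.Balaban1983to89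
open Literature.MathematicalPhysics.QuantumFieldTheory.Balaban1983to89.TreeLengthTorus (TPt TDom tsys torusTreeLen)
open Literature.MathematicalPhysics.QuantumFieldTheory.Balaban1983to89.B13Bound143 (invTau)
open Literature.MathematicalPhysics.QuantumFieldTheory.Balaban1983to89.B9Thm37GlueTorus (tdist1)
open Literature.MathematicalPhysics.QuantumFieldTheory.Balaban1983to89.B5TorusCover (UT)
open Literature.MathematicalPhysics.QuantumFieldTheory.Balaban1983to89.Step (SFConsts)
open Literature.MathematicalPhysics.QuantumFieldTheory.Balaban1983to89.Node00.Sect2 (domSys domCount CPair spaceI domSites Setting Residual)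
open Literature.MathematicalPhysics.QuantumFieldTheory.Balaban1983to89.Node00.W1

variable {c₀ : B13.Consts} {P : Params} {𝔸 : Type*} [NormedRing 𝔸] [NormedAlgebra ℂ 𝔸] [CompleteSpace 𝔸] {M k L : ℕ} [NeZero L] (𝔇 : TermDatum214 c₀ P 𝔸 M k L)
  (χu χcu : (Z : (domSys P M (k + 1)).Dom) → (t : TermLabel P M k L) → ((𝔇.𝒦 Z t).Λ → ℝ) → ℝ)
  (𝒲 : (Z : (domSys P M (k + 1)).Dom) → (t : TermLabel P M k L) → CPair P 𝔸 → TDom P.d (L * domCount P M (k + 1)) → ((𝔇.𝒦 Z t).Λ → ℝ) → ℂ)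
  (𝒪 : (Z : (domSys P M (k + 1)).Dom) → (t : TermLabel P M k L) → OlderTerms P 𝔸 M k → CPair P 𝔸 → TDom P.d (L * domCount P M (k + 1)) →
    ((𝔇.𝒦 Z t).Λ → ℝ) → ℂ)

/-- **THE LOCATED INPUTS OF ONE SLICE** — for the window-dilated member of base point `s₀` of the term `(Z, t)` of the (2.14) datum `𝔇` at the configuration `φ` (J5's family over the
unscaled-field data `χᵘ, χᶜᵘ, 𝒲, 𝒪`), with the estimate's constants `c`, the space tables `(Sg, Rz, cs)`, the (1.18)-size `E₀·e^{−κ_E·d}` of admissible histories, the weight letters `a, a₅`,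
the ball radius `ρb` and the vertex constant `Mv`: the letters (fields `Uσ … 𝒱₁`) and the displayed facts (fields `hpos … hMvP`) that the kernel-keyed readings J6 ∕ J7a ∕ J7b ∕ J8 of this
lineage consume, VERBATIM.  A list of hypotheses; nothing asserted. [cite: Balaban1988RG2Cluster, (2.14)-(2.26) pp.15-17, (1.41) p.11; Balaban1987RG1, (2.9)-(2.13) pp.266-268] -/
structure SliceInputs (c : B13.Consts) {G : Type*} [GaugeGroup G] (Sg : Setting 𝔸 G) (Rz : Residual P 𝔸) (cs : SFConsts) (E₀ κE : ℝ)
    (Z : (domSys P M (k + 1)).Dom) (t : TermLabel P M k L) (φ : CPair P 𝔸) (s₀ a a₅ ρb Mv : ℝ) where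
  /-- located letter `Uσ` -/
  Uσ : Set ℂ
  /-- located letter `Uτ` -/
  Uτ : TDom P.d (L * domCount P M (k + 1)) → Set ℂ
  /-- located letter `γ₂` -/
  γ₂ : ℝ
  /-- located letter `rP` -/
  rP : ℝ
  /-- located letter `a₂₀` -/
  a₂₀ : ℝ
  /-- located letter `w` -/
  w : ℝ
  /-- located letter `qP` -/
  qP : ((𝔇.𝒦 Z t).Λ → ℝ) → ℝ
  /-- located letter `kap` -/
  kap : ℝ
  /-- located letter `kap'` -/
  kap' : ℝ
  /-- located letter `kap''` -/
  kap'' : ℝ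
  /-- located letter `θ` -/
  θ : ℝ
  /-- located letter `θE` -/
  θE : ℝ
  /-- located letter `θΓ` -/
  θΓ : ℝ
  /-- located letter `θC` -/
  θC : ℝ
  /-- located letter `KG` -/
  KG : ℝ
  /-- located letter `KΓ` -/
  KΓ : ℝ
  /-- located letter `KCs` -/
  KCs : ℝ
  /-- located letter `K₀` -/
  K₀ : ℝ
  /-- located letter `KE` -/
  KE : ℝ
  /-- located letter `KG'` -/
  KG' : ℝ
  /-- located letter `KCs'` -/
  KCs' : ℝ
  /-- located letter `θΓ'` -/
  θΓ' : ℝ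
  /-- located letter `θC'` -/
  θC' : ℝ
  /-- located letter `θE'` -/
  θE' : ℝ
  /-- located letter `a'` -/
  a' : ℝ
  /-- located letter `w'` -/
  w' : ℝ
  /-- located letter `cE` -/
  cE : ℝ
  /-- located letter `g` -/
  g : ℝ
  /-- located letter `R` -/
  R : ℝ
  /-- located letter `κ` -/
  κ : ℝ
  /-- located letter `a₀` -/
  a₀ : ℝ
  /-- located letter `w₀` -/
  w₀ : ℝ
  /-- located letter `T` -/
  T : ℝ
  /-- located letter `α₀` -/
  α₀ : ℝ
  /-- located letter `r₁` -/
  r₁ : ℝ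
  /-- located letter `TP` -/
  TP : ℝ
  /-- located letter `K₁` -/
  K₁ : ℝ
  /-- located letter `a₁` -/
  a₁ : ℝ
  /-- located letter `K₂` -/
  K₂ : ℝ
  /-- located letter `a₂` -/
  a₂ : ℝ
  /-- located letter `ac` -/
  ac : ℝ
  /-- located letter `wc` -/
  wc : ℝ
  /-- located letter `𝒱₁` -/
  𝒱₁ : OlderTerms P 𝔸 M k → ℂ → TDom P.d (L * domCount P M (k + 1)) → ((𝔇.𝒦 Z t).Λ → ℝ) → ℂ
  /-- located input `hpos` (see the module docstring) -/
  hpos : ∀ Y : TDom P.d (L * domCount P M (k + 1)), 0 < invTau c ((tsys P.d (L * domCount P M (k + 1))).dj Y)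
  /-- located input `hhalf` (see the module docstring) -/
  hhalf : ∀ Y : TDom P.d (L * domCount P M (k + 1)), invTau c ((tsys P.d (L * domCount P M (k + 1))).dj Y) ≤ 1 / 2
  /-- located input `hUσ` (see the module docstring) -/
  hUσ : IsOpen Uσ
  /-- located input `hUτ` (see the module docstring) -/
  hUτ : ∀ Y, IsOpen (Uτ Y)
  /-- located input `hUexp` (see the module docstring) -/
  hUexp : closedBall (0 : ℂ) (Real.exp c.κ₁) ⊆ Uσ
  /-- located input `hUtau` (see the module docstring) -/
  hUtau : ∀ Y : TDom P.d (L * domCount P M (k + 1)), closedBall (0 : ℂ) ((invTau c ((tsys P.d (L * domCount P M (k + 1))).dj Y))⁻¹) ⊆ Uτ Y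
  /-- located input `hr` (see the module docstring) -/
  hr : 0 < 𝔇.r
  /-- located input `hr'` (see the module docstring) -/
  hr' : 𝔇.r ≤ Real.exp c.κ₁ - 1
  /-- located input `hsubτ` (see the module docstring) -/
  hsubτ : ∀ Y, ∀ x ∈ Set.uIcc (0 : ℝ) 1, closedBall (x : ℂ) 𝔇.r ⊆ Uτ Y
  /-- located input `hχ0` (see the module docstring) -/
  hχ0 : ∀ B, 0 ≤ χu Z t (s₀ • B)
  /-- located input `hχc0` (see the module docstring) -/
  hχc0 : ∀ B, 0 ≤ χcu Z t (s₀ • B)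
  /-- located input `hχm` (see the module docstring) -/
  hχm : Measurable fun B : ((𝔇.𝒦 Z t).Λ) → ℝ => χu Z t (s₀ • B)
  /-- located input `hχcm` (see the module docstring) -/
  hχcm : Measurable fun B : ((𝔇.𝒦 Z t).Λ) → ℝ => χcu Z t (s₀ • B)
  /-- located input `h222` (see the module docstring) -/
  h222 : ∀ B, χu Z t (s₀ • B) * χcu Z t (s₀ • B) ≤ Real.exp (-(γ₂ / 2 * rP ^ 2 * (t.2.card : ℕ)) + γ₂ / 2 * qP B)
  /-- located input `hγ₂` (see the module docstring) -/
  hγ₂ : 0 ≤ γ₂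
  /-- located input `hqP` (see the module docstring) -/
  hqP : ∀ B, qP B ≤ B ⬝ᵥ B
  /-- located input `ha0` (see the module docstring) -/
  ha0 : 0 ≤ a₂₀
  /-- located input `hWm` (see the module docstring) -/
  hWm : ∀ Y, Measurable fun B : (𝔇.𝒦 Z t).Λ → ℝ => 𝒲 Z t φ Y (s₀ • B)
  /-- located input `hAhol` (see the module docstring) -/
  hAhol : ∀ i j, DifferentiableOn ℂ (fun σ => 𝔇.A Z t φ σ i j) {σ | ∀ j, σ j ∈ Uσ}
  /-- located input `hGhol` (see the module docstring) -/
  hGhol : ∀ i j, DifferentiableOn ℂ (fun σ => (𝔇.𝒦 Z t).G2 σ (𝔇.uOf Z t φ) i j) {σ | ∀ j, σ j ∈ Uσ}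
  /-- located input `hAs` (see the module docstring) -/
  hAs : ∀ σ : TPt P.d (domCount P M (k + 1)) → ℂ, (∀ j, σ j ∈ Uσ) → (𝔇.A Z t φ σ).IsSymm
  /-- located input `hfibN` (see the module docstring) -/
  hfibN : ∀ x : UT 𝔇.Nf, (Finset.univ.filter fun j => (𝔇.𝒦 Z t).locN j = x).card ≤ (𝔇.𝒦 Z t).m
  /-- located input `hkap''` (see the module docstring) -/
  hkap'' : 0 < kap''
  /-- located input `h1` (see the module docstring) -/
  h1 : kap'' < kap'
  /-- located input `h2` (see the module docstring) -/
  h2 : kap' < kap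
  /-- located input `hθE` (see the module docstring) -/
  hθE : 0 ≤ θE
  /-- located input `hθΓ` (see the module docstring) -/
  hθΓ : 0 ≤ θΓ
  /-- located input `hθC` (see the module docstring) -/
  hθC : 0 ≤ θC
  /-- located input `hKG` (see the module docstring) -/
  hKG : 0 ≤ KG
  /-- located input `hKΓ` (see the module docstring) -/
  hKΓ : 0 ≤ KΓ
  /-- located input `hKCs` (see the module docstring) -/
  hKCs : 0 ≤ KCs
  /-- located input `hK₀` (see the module docstring) -/
  hK₀ : 0 ≤ K₀
  /-- located input `hKE` (see the module docstring) -/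
  hKE : 0 ≤ KE
  /-- located input `hG` (see the module docstring) -/
  hG : ∀ σ : TPt P.d (domCount P M (k + 1)) → ℂ, (∀ j, σ j ∈ Uσ) → ∀ b j, ‖(𝔇.𝒦 Z t).G2 σ (𝔇.uOf Z t φ) b j‖ ≤ KG * Real.exp (-(kap * tdist1 𝔇.Nf ((𝔇.𝒦 Z t).locΛ b) ((𝔇.𝒦 Z t).locN j)))
  /-- located input `hΓ₀` (see the module docstring) -/
  hΓ₀ : ∀ b j, ‖(𝔇.𝒦 Z t).Γ₀ b j‖ ≤ KΓ * Real.exp (-(kap * tdist1 𝔇.Nf ((𝔇.𝒦 Z t).locΛ b) ((𝔇.𝒦 Z t).locN j)))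
  /-- located input `hCs` (see the module docstring) -/
  hCs : ∀ σ : TPt P.d (domCount P M (k + 1)) → ℂ, (∀ j, σ j ∈ Uσ) → ∀ b b', ‖(𝔇.A Z t φ σ)⁻¹ b b'‖ ≤ KCs * Real.exp (-(kap * tdist1 𝔇.Nf ((𝔇.𝒦 Z t).locΛ b) ((𝔇.𝒦 Z t).locΛ b')))
  /-- located input `hC216` (see the module docstring) -/
  hC216 : ∀ b b', ‖(𝔇.𝒦 Z t).C b b'‖ ≤ K₀ * Real.exp (-(kap * tdist1 𝔇.Nf ((𝔇.𝒦 Z t).locΛ b) ((𝔇.𝒦 Z t).locΛ b')))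
  /-- located input `hCE` (see the module docstring) -/
  hCE : ∀ b b', ‖((𝔇.𝒦 Z t).C⁻¹.map (algebraMap ℝ ℂ)) b b'‖ ≤ KE * Real.exp (-(kap * tdist1 𝔇.Nf ((𝔇.𝒦 Z t).locΛ b) ((𝔇.𝒦 Z t).locΛ b')))
  /-- located input `hdΓ` (see the module docstring) -/
  hdΓ : ∀ σ : TPt P.d (domCount P M (k + 1)) → ℂ, (∀ j, σ j ∈ Uσ) → ∀ b j, ‖((𝔇.𝒦 Z t).G2 σ (𝔇.uOf Z t φ) - (𝔇.𝒦 Z t).Γ₀.map (algebraMap ℝ ℂ)) b j‖ ≤ θΓ * Real.exp (-(kap * tdist1 𝔇.Nf ((𝔇.𝒦 Z t).locΛ b) ((𝔇.𝒦 Z t).locN j)))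
  /-- located input `hdC` (see the module docstring) -/
  hdC : ∀ σ : TPt P.d (domCount P M (k + 1)) → ℂ, (∀ j, σ j ∈ Uσ) → ∀ b b', ‖((𝔇.A Z t φ σ)⁻¹ - (𝔇.𝒦 Z t).C.map (algebraMap ℝ ℂ)) b b'‖ ≤ θC * Real.exp (-(kap * tdist1 𝔇.Nf ((𝔇.𝒦 Z t).locΛ b) ((𝔇.𝒦 Z t).locΛ b')))
  /-- located input `hdE` (see the module docstring) -/
  hdE : ∀ σ : TPt P.d (domCount P M (k + 1)) → ℂ, (∀ j, σ j ∈ Uσ) → ∀ b b', ‖(𝔇.A Z t φ σ - (𝔇.𝒦 Z t).C⁻¹.map (algebraMap ℝ ℂ)) b b'‖ ≤ θE * Real.exp (-(kap * tdist1 𝔇.Nf ((𝔇.𝒦 Z t).locΛ b) ((𝔇.𝒦 Z t).locΛ b')))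
  /-- located input `hKG'` (see the module docstring) -/
  hKG' : (1 + ρb) * KG ≤ KG'
  /-- located input `hKCs'` (see the module docstring) -/
  hKCs' : ((1 - ρb) ^ 2)⁻¹ * KCs ≤ KCs'
  /-- located input `hθΓ'` (see the module docstring) -/
  hθΓ' : θΓ + ρb * KG ≤ θΓ'
  /-- located input `hθC'` (see the module docstring) -/
  hθC' : θC + ρb * (2 + ρb) * ((1 - ρb) ^ 2)⁻¹ * KCs ≤ θC'
  /-- located input `hθE'` (see the module docstring) -/
  hθE' : θE + ρb * (2 + ρb) * (θE + KE) ≤ θE'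
  /-- located input `ha'` (see the module docstring) -/
  ha' : (1 + ρb) ^ 2 * a₂₀ ≤ a'
  /-- located input `hw'` (see the module docstring) -/
  hw' : (1 + ρb) ^ 2 * w ≤ w'
  /-- located input `hθEle` (see the module docstring) -/
  hθEle : θE' ≤ θ
  /-- located input `hθΓle` (see the module docstring) -/
  hθΓle : θΓ' ≤ θ
  /-- located input `hθR1le` (see the module docstring) -/
  hθR1le : ((𝔇.𝒦 Z t).m * (1 + 2 / (kap - kap')) ^ 𝔇.ν) * ((𝔇.𝒦 Z t).m * (1 + 2 / (kap' - kap'')) ^ 𝔇.ν) * (θΓ' * KCs' * KG' + KΓ * θC' * KG' + KΓ * K₀ * θΓ') ≤ θ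
  /-- located input `hsmallKθ` (see the module docstring) -/
  hsmallKθ : K₀ * ((𝔇.𝒦 Z t).m * (1 + 2 / kap) ^ 𝔇.ν) * (θ * ((𝔇.𝒦 Z t).m * (1 + 2 / kap'') ^ 𝔇.ν)) < 1
  /-- located input `hc0` (see the module docstring) -/
  hc0 : 0 ≤ cE
  /-- located input `hc` (see the module docstring) -/
  hc : ∀ i, (𝔇.𝒦 Z t).hC.1.eigenvalues i ≤ cE
  /-- located input `hαc` (see the module docstring) -/
  hαc : (2 * (θ * ((𝔇.𝒦 Z t).m * (1 + 2 / kap'') ^ 𝔇.ν)) + (γ₂ + a')) * cE ≤ 1 / 2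
  /-- located input `hg` (see the module docstring) -/
  hg : 0 ≤ g
  /-- located input `hΓq` (see the module docstring) -/
  hΓq : ∀ X : (𝔇.𝒦 Z t).Λ ⊕ (𝔇.𝒦 Z t).C₀ → ℝ, ((𝔇.𝒦 Z t).Γ₀ *ᵥ X) ⬝ᵥ ((𝔇.𝒦 Z t).C *ᵥ ((𝔇.𝒦 Z t).Γ₀ *ᵥ X)) ≤ g * (X ⬝ᵥ X)
  /-- located input `hsmall` (see the module docstring) -/
  hsmall : (2 * (θ * ((𝔇.𝒦 Z t).m * (1 + 2 / kap'') ^ 𝔇.ν)) + (γ₂ + a')) * (1 + 2 * cE * g) ≤ 1 / 2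
  /-- located input `hPa` (see the module docstring) -/
  hPa : a ≤ γ₂ * rP ^ 2
  /-- located input `hvol` (see the module docstring) -/
  hvol : 2 * (K₀ * ((𝔇.𝒦 Z t).m * (1 + 2 / kap) ^ 𝔇.ν) * (θ * ((𝔇.𝒦 Z t).m * (1 + 2 / kap'') ^ 𝔇.ν)) * (1 + (1 - K₀ * ((𝔇.𝒦 Z t).m * (1 + 2 / kap) ^ 𝔇.ν) * (θ * ((𝔇.𝒦 Z t).m * (1 + 2 / kap'') ^ 𝔇.ν)))⁻¹) / 2) * (Fintype.card (𝔇.𝒦 Z t).Λ : ℝ) + w' + (2 * (θ * ((𝔇.𝒦 Z t).m * (1 + 2 / kap'') ^ 𝔇.ν)) + (γ₂ + a')) * cE * (Fintype.card (𝔇.𝒦 Z t).Λ : ℝ) + (2 * (θ * ((𝔇.𝒦 Z t).m * (1 + 2 / kap'') ^ 𝔇.ν)) + (γ₂ + a')) * (1 + 2 * cE * g) * (Fintype.card ((𝔇.𝒦 Z t).Λ ⊕ (𝔇.𝒦 Z t).C₀) : ℝ) ≤ a₅ * ((Z.1).card : ℝ)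
  /-- located input `hχe` (see the module docstring) -/
  hχe : ∀ B, χu Z t (s₀ • (-B)) = χu Z t (s₀ • B)
  /-- located input `hχce` (see the module docstring) -/
  hχce : ∀ B, χcu Z t (s₀ • (-B)) = χcu Z t (s₀ • B)
  /-- located input `hK₁` (see the module docstring) -/
  hK₁ : 0 ≤ K₁
  /-- located input `hK₂` (see the module docstring) -/
  hK₂ : 0 ≤ K₂
  /-- located input `ha₁` (see the module docstring) -/
  ha₁ : 0 ≤ a₁
  /-- located input `hac₀` (see the module docstring) -/
  hac₀ : a' ≤ ac
  /-- located input `hac₂` (see the module docstring) -/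
  hac₂ : a₂ ≤ ac
  /-- located input `hac₁` (see the module docstring) -/
  hac₁ : 2 * a₁ + a' ≤ ac
  /-- located input `hwc` (see the module docstring) -/
  hwc : Real.exp w₀ * (K₂ + K₁ ^ 2 * Real.exp (w' + w₀)) ≤ Real.exp wc
  /-- located input `hαc_c` (see the module docstring) -/
  hαc_c : (2 * (θ * ((𝔇.𝒦 Z t).m * (1 + 2 / kap'') ^ 𝔇.ν)) + (γ₂ + ac)) * cE ≤ 1 / 2
  /-- located input `hsmall_c` (see the module docstring) -/
  hsmall_c : (2 * (θ * ((𝔇.𝒦 Z t).m * (1 + 2 / kap'') ^ 𝔇.ν)) + (γ₂ + ac)) * (1 + 2 * cE * g) ≤ 1 / 2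
  /-- located input `hvol_c` (see the module docstring) -/
  hvol_c : 2 * (K₀ * ((𝔇.𝒦 Z t).m * (1 + 2 / kap) ^ 𝔇.ν) * (θ * ((𝔇.𝒦 Z t).m * (1 + 2 / kap'') ^ 𝔇.ν)) * (1 + (1 - K₀ * ((𝔇.𝒦 Z t).m * (1 + 2 / kap) ^ 𝔇.ν) * (θ * ((𝔇.𝒦 Z t).m * (1 + 2 / kap'') ^ 𝔇.ν)))⁻¹) / 2) * (Fintype.card (𝔇.𝒦 Z t).Λ : ℝ) + wc + (2 * (θ * ((𝔇.𝒦 Z t).m * (1 + 2 / kap'') ^ 𝔇.ν)) + (γ₂ + ac)) * cE * (Fintype.card (𝔇.𝒦 Z t).Λ : ℝ) + (2 * (θ * ((𝔇.𝒦 Z t).m * (1 + 2 / kap'') ^ 𝔇.ν)) + (γ₂ + ac)) * (1 + 2 * cE * g) * (Fintype.card ((𝔇.𝒦 Z t).Λ ⊕ (𝔇.𝒦 Z t).C₀) : ℝ) ≤ a₅ * ((Z.1).card : ℝ)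
  /-- located input `hχ1` (see the module docstring) -/
  hχ1 : ∀ B, χu Z t (s₀ • B) * χcu Z t (s₀ • B) ≤ 1
  /-- located input `hκ` (see the module docstring) -/
  hκ : 0 ≤ κ
  /-- located input `hbox` (see the module docstring) -/
  hbox : ∀ B, B ⬝ᵥ B < R ^ 2 → χu Z t (s₀ • B) * χcu Z t (s₀ • B) = 1
  /-- located input `ha₀` (see the module docstring) -/
  ha₀ : 0 ≤ a₀
  /-- located input `hαc_b` (see the module docstring) -/
  hαc_b : (2 * (θ * ((𝔇.𝒦 Z t).m * (1 + 2 / kap'') ^ 𝔇.ν)) + (κ + a₀)) * cE ≤ 1 / 2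
  /-- located input `hsmall_b` (see the module docstring) -/
  hsmall_b : (2 * (θ * ((𝔇.𝒦 Z t).m * (1 + 2 / kap'') ^ 𝔇.ν)) + (κ + a₀)) * (1 + 2 * cE * g) ≤ 1 / 2
  /-- located input `hvol_b` (see the module docstring) -/
  hvol_b : 2 * (K₀ * ((𝔇.𝒦 Z t).m * (1 + 2 / kap) ^ 𝔇.ν) * (θ * ((𝔇.𝒦 Z t).m * (1 + 2 / kap'') ^ 𝔇.ν)) * (1 + (1 - K₀ * ((𝔇.𝒦 Z t).m * (1 + 2 / kap) ^ 𝔇.ν) * (θ * ((𝔇.𝒦 Z t).m * (1 + 2 / kap'') ^ 𝔇.ν)))⁻¹) / 2) * (Fintype.card (𝔇.𝒦 Z t).Λ : ℝ) + w₀ + (2 * (θ * ((𝔇.𝒦 Z t).m * (1 + 2 / kap'') ^ 𝔇.ν)) + (κ + a₀)) * cE * (Fintype.card (𝔇.𝒦 Z t).Λ : ℝ) + (2 * (θ * ((𝔇.𝒦 Z t).m * (1 + 2 / kap'') ^ 𝔇.ν)) + (κ + a₀)) * (1 + 2 * cE * g) * (Fintype.card ((𝔇.𝒦 Z t).Λ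 ⊕ (𝔇.𝒦 Z t).C₀) : ℝ) ≤ a₅ * ((Z.1).card : ℝ)
  /-- located input `hα₀` (see the module docstring) -/
  hα₀ : 0 ≤ α₀
  /-- located input `hαc_f` (see the module docstring) -/
  hαc_f : (2 * (θ * ((𝔇.𝒦 Z t).m * (1 + 2 / kap'') ^ 𝔇.ν)) + α₀) * cE ≤ 1 / 2
  /-- located input `hsmall_f` (see the module docstring) -/
  hsmall_f : (2 * (θ * ((𝔇.𝒦 Z t).m * (1 + 2 / kap'') ^ 𝔇.ν)) + α₀) * (1 + 2 * cE * g) ≤ 1 / 2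
  /-- located input `hr₁` (see the module docstring) -/
  hr₁ : r₁ ^ 2 ≤ rP ^ 2
  /-- located input `hPa1` (see the module docstring) -/
  hPa1 : a ≤ γ₂ * r₁ ^ 2
  /-- located input `hA` (see the module docstring) -/
  hA : ∀ σ : TPt P.d (domCount P M (k + 1)) → ℂ, (∀ j, σ j ∈ Uσ) → ((𝔇.A Z t φ σ).map Complex.re).PosDef
  /-- located input `hθEle0` (see the module docstring) -/
  hθEle0 : θE ≤ θ
  /-- located input `hθΓle0` (see the module docstring) -/
  hθΓle0 : θΓ ≤ θ
  /-- located input `hθR1le0` (see the module docstring) -/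
  hθR1le0 : ((𝔇.𝒦 Z t).m * (1 + 2 / (kap - kap')) ^ 𝔇.ν) * ((𝔇.𝒦 Z t).m * (1 + 2 / (kap' - kap'')) ^ 𝔇.ν) * (θΓ * KCs * KG + KΓ * θC * KG + KΓ * K₀ * θΓ) ≤ θ
  /-- located input `hαc_0` (see the module docstring) -/
  hαc_0 : (2 * (θ * ((𝔇.𝒦 Z t).m * (1 + 2 / kap'') ^ 𝔇.ν)) + (γ₂ + a₀)) * cE ≤ 1 / 2
  /-- located input `hsmall_0` (see the module docstring) -/
  hsmall_0 : (2 * (θ * ((𝔇.𝒦 Z t).m * (1 + 2 / kap'') ^ 𝔇.ν)) + (γ₂ + a₀)) * (1 + 2 * cE * g) ≤ 1 / 2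
  /-- located input `hvol_0` (see the module docstring) -/
  hvol_0 : 2 * (K₀ * ((𝔇.𝒦 Z t).m * (1 + 2 / kap) ^ 𝔇.ν) * (θ * ((𝔇.𝒦 Z t).m * (1 + 2 / kap'') ^ 𝔇.ν)) * (1 + (1 - K₀ * ((𝔇.𝒦 Z t).m * (1 + 2 / kap) ^ 𝔇.ν) * (θ * ((𝔇.𝒦 Z t).m * (1 + 2 / kap'') ^ 𝔇.ν)))⁻¹) / 2) * (Fintype.card (𝔇.𝒦 Z t).Λ : ℝ) + w₀ + (2 * (θ * ((𝔇.𝒦 Z t).m * (1 + 2 / kap'') ^ 𝔇.ν)) + (γ₂ + a₀)) * cE * (Fintype.card (𝔇.𝒦 Z t).Λ : ℝ) + (2 * (θ * ((𝔇.𝒦 Z t).m * (1 + 2 / kap'') ^ 𝔇.ν)) + (γ₂ + a₀)) * (1 + 2 * cE * g) * (Fintype.card ((𝔇.𝒦 Z t).Λ ⊕ (𝔇.𝒦 Z t).C₀) : ℝ) ≤ a₅ * ((Z.1).card : ℝ)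
  /-- located input `hOm_all` (see the module docstring) -/
  hOm_all : ∀ (old : OlderTerms P 𝔸 M k) (Y : TDom P.d (L * domCount P M (k + 1))), Measurable fun B : (𝔇.𝒦 Z t).Λ → ℝ => 𝒪 Z t old φ Y (s₀ • B)
  /-- located input `h220U_all` (see the module docstring) -/
  h220U_all : ∀ old : OlderTerms P 𝔸 M k, (∀ (j : Fin (k + 1)) (Y : (domSys P M j).Dom) (ψ : CPair P 𝔸), ψ ∈ spaceI Sg Rz M j (domSites P M j Y) cs.α₀ cs.α₁ → ‖old j Y ψ‖ ≤ E₀ * Real.exp (-(κE * torusTreeLen Y.1))) → ∀ τ : TDom P.d (L * domCount P M (k + 1)) → ℂ, (∀ Y, τ Y ∈ Uτ Y) → ∀ B, ∑ Y ∈ t.1, ‖τ Y‖ * (‖(((s₀ : ℝ) : ℂ) ^ 2)⁻¹ * 𝒲 Z t φ Y (s₀ • B)‖ + ‖𝒪 Z t old φ Y (s₀ • B)‖) ≤ a₂₀ / 2 * (B ⬝ᵥ B) + w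
  /-- located input `h220Ub_all` (see the module docstring) -/
  h220Ub_all : ∀ old : OlderTerms P 𝔸 M k, (∀ (j : Fin (k + 1)) (Y : (domSys P M j).Dom) (ψ : CPair P 𝔸), ψ ∈ spaceI Sg Rz M j (domSites P M j Y) cs.α₀ cs.α₁ → ‖old j Y ψ‖ ≤ E₀ * Real.exp (-(κE * torusTreeLen Y.1))) → ∀ b ∈ ball (1 : ℂ) ρb, ∀ τ : TDom P.d (L * domCount P M (k + 1)) → ℂ, (∀ Y, τ Y ∈ Uτ Y) → ∀ B, ∑ Y ∈ t.1, ‖τ Y‖ * ‖b ^ 2 * ((((s₀ : ℝ) : ℂ) ^ 2)⁻¹ * 𝒲 Z t φ Y (s₀ • B)) + 𝒪 Z t old φ Y (s₀ • B)‖ ≤ a' / 2 * (B ⬝ᵥ B) + w'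
  /-- located input `hw₀U_all` (see the module docstring) -/
  hw₀U_all : ∀ old : OlderTerms P 𝔸 M k, (∀ (j : Fin (k + 1)) (Y : (domSys P M j).Dom) (ψ : CPair P 𝔸), ψ ∈ spaceI Sg Rz M j (domSites P M j Y) cs.α₀ cs.α₁ → ‖old j Y ψ‖ ≤ E₀ * Real.exp (-(κE * torusTreeLen Y.1))) → ∀ τ : TDom P.d (L * domCount P M (k + 1)) → ℂ, (∀ Y, τ Y ∈ Uτ Y) → ∑ Y ∈ t.1, ‖τ Y‖ * ‖𝒪 Z t old φ Y 0‖ ≤ w₀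
  /-- located input `h220V0_all` (see the module docstring) -/
  h220V0_all : ∀ old : OlderTerms P 𝔸 M k, (∀ (j : Fin (k + 1)) (Y : (domSys P M j).Dom) (ψ : CPair P 𝔸), ψ ∈ spaceI Sg Rz M j (domSites P M j Y) cs.α₀ cs.α₁ → ‖old j Y ψ‖ ≤ E₀ * Real.exp (-(κE * torusTreeLen Y.1))) → ∀ τ : TDom P.d (L * domCount P M (k + 1)) → ℂ, (∀ Y, τ Y ∈ Uτ Y) → ∀ B : (𝔇.𝒦 Z t).Λ → ℝ, ∑ Y ∈ t.1, ‖τ Y‖ * ‖𝒪 Z t old φ Y 0‖ ≤ a₀ / 2 * (B ⬝ᵥ B) + w₀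
  /-- located input `hOhol` (see the module docstring) -/
  hOhol : ∀ (O : Set ℂ), IsOpen O → ∀ cv : ℂ → OlderTerms P 𝔸 M k, (∀ (j : Fin (k + 1)) (Y : (domSys P M j).Dom) (ψ : CPair P 𝔸), ψ ∈ spaceI Sg Rz M j (domSites P M j Y) cs.α₀ cs.α₁ → DifferentiableOn ℂ (fun z => cv z j Y ψ) O ∧ ∀ z ∈ O, ‖cv z j Y ψ‖ ≤ E₀ * Real.exp (-(κE * torusTreeLen Y.1))) → ∀ (Y : TDom P.d (L * domCount P M (k + 1))) (A : (𝔇.𝒦 Z t).Λ → ℝ), DifferentiableOn ℂ (fun z => 𝒪 Z t (cv z) φ Y A) O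
  /-- located input `hV₁m_all` (see the module docstring) -/
  hV₁m_all : ∀ (old : OlderTerms P 𝔸 M k) (b : ℂ) (Y : TDom P.d (L * domCount P M (k + 1))), Measurable (𝒱₁ old b Y)
  /-- located input `hV₁o_all` (see the module docstring) -/
  hV₁o_all : ∀ (old : OlderTerms P 𝔸 M k) (b : ℂ) (Y : TDom P.d (L * domCount P M (k + 1))) (B : (𝔇.𝒦 Z t).Λ → ℝ), 𝒱₁ old b Y (-B) = -𝒱₁ old b Y B
  /-- located input `h1eU_all` (see the module docstring) -/
  h1eU_all : ∀ old : OlderTerms P 𝔸 M k, (∀ (j : Fin (k + 1)) (Y : (domSys P M j).Dom) (ψ : CPair P 𝔸), ψ ∈ spaceI Sg Rz M j (domSites P M j Y) cs.α₀ cs.α₁ → ‖old j Y ψ‖ ≤ E₀ * Real.exp (-(κE * torusTreeLen Y.1))) → ∀ b ∈ ball (1 : ℂ) ρb, ∀ τ : TDom P.d (L * domCount P M (k + 1)) → ℂ, (∀ Y, τ Y ∈ Uτ Y) → ∀ B, ∑ Y ∈ t.1, ‖τ Y‖ * ‖(b ^ 2 * ((((s₀ : ℝ) : ℂ) ^ 2)⁻¹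 * 𝒲 Z t φ Y (s₀ • B)) + 𝒪 Z t old φ Y (s₀ • B)) - 𝒪 Z t old φ Y 0‖ ≤ s₀ * (K₁ * Real.exp (a₁ / 2 * (B ⬝ᵥ B)))
  /-- located input `h2eU_all` (see the module docstring) -/
  h2eU_all : ∀ old : OlderTerms P 𝔸 M k, (∀ (j : Fin (k + 1)) (Y : (domSys P M j).Dom) (ψ : CPair P 𝔸), ψ ∈ spaceI Sg Rz M j (domSites P M j Y) cs.α₀ cs.α₁ → ‖old j Y ψ‖ ≤ E₀ * Real.exp (-(κE * torusTreeLen Y.1))) → ∀ b ∈ ball (1 : ℂ) ρb, ∀ τ : TDom P.d (L * domCount P M (k + 1)) → ℂ, (∀ Y, τ Y ∈ Uτ Y) → ∀ B, ∑ Y ∈ t.1, ‖τ Y‖ * ‖(b ^ 2 * ((((s₀ : ℝ) : ℂ) ^ 2)⁻¹ * 𝒲 Z t φ Y (s₀ • B)) + 𝒪 Z t old φ Y (s₀ • B)) - 𝒪 Z t old φ Y 0 - 𝒱₁ old b Y B‖ ≤ s₀ ^ 2 * (K₂ * Real.exp (a₂ / 2 * (B ⬝ᵥ B)))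
  /-- located input `hR` (see the module docstring) -/
  hR : Real.exp (-(κ / 2 * R ^ 2)) ≤ T * s₀ ^ 2
  /-- located input `hTP` (see the module docstring) -/
  hTP : Real.exp (-(γ₂ / 2 * (rP ^ 2 - r₁ ^ 2))) ≤ TP * s₀ ^ 2
  /-- located input `hMvT` (see the module docstring) -/
  hMvT : 1 + T ≤ Mv
  /-- located input `hMvP` (see the module docstring) -/
  hMvP : TP ≤ Mv

end YMDAG.N22.W1

end
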